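import Mathlib
import HarnessLib
import Summits.ResolutionOfSingularities.ResolutionOfSingularities.Theorems.WildQuotientsWildQuotientResolutionS1aKillExo
import Summits.ResolutionOfSingularities.ResolutionOfSingularities.Theorems.WildQuotientsWildQuotientResolutionS1aKillLeast

/-!
# S1a — NORMALISE: weight scaling `(f, w, δ) ↦ (f, c·w, c·δ)` of kill data and the Veronese embedding `R^w ↪ R^{c w}`

[OURS · L1 W4.5c · lead-1 g11; plan-1 ASSIGNMENT v10.27 (2) / v10.29 (K4) «NORMALISE»] — NOT statements of the manuscript; counted 0; AI-level
work, weaker than expert review. Crux stmt-ResolutionOfSingularities-17941 `CyclicQuotientFourfolds`, line `s1a-logminvertex` v11, K-side. Route-independent;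
pure algebra. Purpose: kill charts of one component come with frames `(fᵢ, wᵢ)` and shifts `δᵢ`; to glue them into ONE Rees filtration (cover theorems
p639895/p643066) they are rescaled to a common shift `D = cᵢ δᵢ` — this file shows that rescaling preserves every clause of the kill data.

* `weight_smul`, ★ `weightedFiltration_smul` — **`𝒥ₙ(f, c·w) = 𝒥_{⌈n/c⌉}(f, w)`** (`0 < c`);
* `admissible_smul` — (a′)_δ for `(f,w)` ⇒ (a′)_{cδ} for `(f, c·w)`; `not_admissible_succ_smul` — the optimality witness scales (`¬(a′)_{δ+1}` at `(n₀,y₀)` ⇒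
  `¬(a′)_{cδ+1}` at `(c n₀, y₀)`); `map_weightedFiltration_smul_le` — σ-adaptedness scales;
* `veroneseMap c : R^w →+* R^{c·w}` (`t ↦ t^c` on Laurent polynomials, `AddMonoidAlgebra.mapDomainRingHom` of `n ↦ c n`), with `coe_veroneseMap`,
  `veroneseMap_s` (`s ↦ s^c`), `veroneseMap_u'` (`fᵢ t^{wᵢ} ↦ fᵢ t^{c wᵢ}`), `veroneseMap_algebraMap`, `veroneseMap_sigmaR` (intertwines `σ_R`),
  `map_veroneseMap_augmentationIdeal_le`, `map_veroneseMap_vertexIdeal`;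
* ★★ `cobordantKillCert_smul` — a certificate `β s^δ` for `(f, w)` (+ (a′)_δ) gives the certificate `β s^{cδ}` for `(f, c·w)` — so by KC1 the kill
  clause holds on the charts of the RESCALED frame, and K-EXO / K-LEAST / K-U apply to any common rescaling of two kill charts.
-/

set_option linter.dupNamespace false

noncomputable section

open Literature.AlgebraicGeometry.Resolution
open scoped LaurentPolynomial
open LaurentPolynomial
open Summit.ResolutionOfSingularities.ResolutionOfSingularities.Theorems.WildQuotientResolution.S1.CoarseChart

namespace Summit.ResolutionOfSingularities.ResolutionOfSingularities.Theorems.WildQuotientResolution.S1.KillCert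

universe u

variable {B : Type u} [CommRing B] {c : ℕ} (f : Fin c → B) (w : Fin c → ℕ)

/-! ## `𝒥ₙ(f, c·w) = 𝒥_{⌈n/c⌉}(f, w)` -/

/-- Weights scale linearly: `weight (e·w) α = e · weight w α`. [folklore] -/
theorem weight_smul (e : ℕ) (α : Fin c →₀ ℕ) : Finsupp.weight (e • w) α = e * Finsupp.weight w α := by
  simp only [Finsupp.weight_apply, Finsupp.sum, Pi.smul_apply, smul_eq_mul, Finset.mul_sum]
  exact Finset.sum_congr rfl fun i _ => by ring

/-- The weighted monomials scale: weight `≥ n` for `e·w` iff weight `≥ ⌈n/e⌉` for `w`. [folklore] -/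
theorem weightedMonomials_smul {e : ℕ} (he : 0 < e) (n : ℕ) :
    weightedMonomials f (e • w) n = weightedMonomials f w (n ⌈/⌉ e) := by
  ext m
  constructor
  · rintro ⟨α, hα, rfl⟩
    refine ⟨α, ?_, rfl⟩
    rw [weight_smul] at hα
    exact (ceilDiv_le_iff_le_mul he).mpr hα
  · rintro ⟨α, hα, rfl⟩
    refine ⟨α, ?_, rfl⟩
    rw [weight_smul]
    exact (ceilDiv_le_iff_le_mul he).mp hα

/-- ★ **NORMALISE**: `𝒥ₙ(f, e·w) = 𝒥_{⌈n/e⌉}(f, w)` for `0 < e`. [OURS · L1 W4.5c; folklore on weighted filtrations] -/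
theorem weightedFiltration_smul {e : ℕ} (he : 0 < e) (n : ℕ) :
    (weightedFiltration f (e • w)).ideal n = (weightedFiltration f w).ideal (n ⌈/⌉ e) := by
  rw [weightedFiltration_ideal, weightedFiltration_ideal, weightedMonomials_smul f w he]

/-- `⌈(e n)/e⌉ = n`. -/
theorem mul_ceilDiv_cancel {e : ℕ} (he : 0 < e) (n : ℕ) : (e * n) ⌈/⌉ e = n := by
  apply le_antisymm
  · exact (ceilDiv_le_iff_le_mul he).mpr le_rfl
  · exact le_ceilDiv_of_mul_le he le_rfl

/-- `⌈(e n + 1)/e⌉ = n + 1` for `0 < e`. -/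
theorem mul_add_one_ceilDiv {e : ℕ} (he : 0 < e) (n : ℕ) : (e * n + 1) ⌈/⌉ e = n + 1 := by
  apply le_antisymm
  · exact (ceilDiv_le_iff_le_mul he).mpr (by nlinarith)
  · exact succ_le_ceilDiv_of_mul_lt he (by omega)

/-- On the Veronese degrees nothing changes: `𝒥_{e n}(f, e·w) = 𝒥ₙ(f, w)`. -/
theorem weightedFiltration_smul_mul {e : ℕ} (he : 0 < e) (n : ℕ) :
    (weightedFiltration f (e • w)).ideal (e * n) = (weightedFiltration f w).ideal n := by
  rw [weightedFiltration_smul f w he, mul_ceilDiv_cancel he]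

/-! ## The kill data scale -/

section Scale

variable (σ : B ≃+* B) {e : ℕ} (he : 0 < e)

include he in
/-- σ-adaptedness scales. -/
theorem map_weightedFiltration_smul_le
    (hσJ : ∀ n : ℕ, ((weightedFiltration f w).ideal n).map (σ : B →+* B) ≤ (weightedFiltration f w).ideal n) (n : ℕ) :
    ((weightedFiltration f (e • w)).ideal n).map (σ : B →+* B) ≤ (weightedFiltration f (e • w)).ideal n := by
  rw [weightedFiltration_smul f w he]
  exact hσJ _

include he in
/-- **(a′) scales**: boundary-admissibility with shift `δ` for `(f, w)` gives shift `e δ` for `(f, e·w)`. [OURS · L1 W4.5c] -/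
theorem admissible_smul (β : B) (δ : ℕ)
    (hadm : ∀ (n : ℕ) (y : B), y ∈ (weightedFiltration f w).ideal n →
      σ y - y ∈ Ideal.span {β} * (weightedFiltration f w).ideal (n + δ))
    (n : ℕ) (y : B) (hy : y ∈ (weightedFiltration f (e • w)).ideal n) :
    σ y - y ∈ Ideal.span {β} * (weightedFiltration f (e • w)).ideal (n + e * δ) := by
  rw [weightedFiltration_smul f w he] at hy ⊢
  refine Ideal.mul_mono_right ((weightedFiltration f w).antitone ?_) (hadm _ y hy)
  exact ceilDiv_le_of_le_mul he (by nlinarith [le_mul_ceilDiv he n])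

include he in
/-- **The optimality witness scales**: if (a′)_{δ+1} fails at `(n₀, y₀)` for `(f, w)`, then (a′)_{eδ+1} fails at `(e n₀, y₀)` for `(f, e·w)`.
[OURS · L1 W4.5c] -/
theorem not_admissible_succ_smul (β : B) (δ : ℕ) {n₀ : ℕ} {y₀ : B} (hy₀ : y₀ ∈ (weightedFiltration f w).ideal n₀)
    (hnot : σ y₀ - y₀ ∉ Ideal.span {β} * (weightedFiltration f w).ideal (n₀ + δ + 1)) :
    y₀ ∈ (weightedFiltration f (e • w)).ideal (e * n₀) ∧
      σ y₀ - y₀ ∉ Ideal.span {β} * (weightedFiltration f (e • w)).ideal (e * n₀ + e * δ + 1) := by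
  refine ⟨by rwa [weightedFiltration_smul_mul f w he], ?_⟩
  rwa [show e * n₀ + e * δ + 1 = e * (n₀ + δ) + 1 by ring, weightedFiltration_smul f w he, mul_add_one_ceilDiv he]

end Scale

/-! ## The Veronese embedding `R^w ↪ R^{e·w}`, `t ↦ t^e` -/

section Veronese

variable (e : ℕ)

/-- `n ↦ e·n` on the exponents. -/
abbrev scaleExp : ℤ →+ ℤ := AddMonoidHom.mulLeft (e : ℤ)

/-- `t ↦ t^e` on Laurent polynomials, as a ring homomorphism. [folklore] -/
def veroneseT : B[T;T⁻¹] →+* B[T;T⁻¹] := AddMonoidAlgebra.mapDomainRingHom B (scaleExp e)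

/-- Unfolding `veroneseT`. -/
theorem veroneseT_apply (x : B[T;T⁻¹]) : veroneseT e x = AddMonoidAlgebra.mapDomain (scaleExp e) x := rfl

variable {e} (he : 0 < e)

include he in
/-- `n ↦ e·n` is injective for `0 < e`. -/
theorem scaleExp_injective : Function.Injective (scaleExp e) := by
  intro a b h
  have : (e : ℤ) * a = (e : ℤ) * b := h
  exact mul_left_cancel₀ (by exact_mod_cast he.ne') this

include he in
/-- Coefficients of `x(t^e)`: `coeff_{e n} = coeff_n x`. -/
theorem coeff_veroneseT_mul (x : B[T;T⁻¹]) (n : ℤ) : (veroneseT e x).coeff ((e : ℤ) * n) = x.coeff n := by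
  rw [veroneseT_apply, AddMonoidAlgebra.mapDomain, AddMonoidAlgebra.coeff_ofCoeff]
  exact Finsupp.mapDomain_apply (scaleExp_injective he) x.coeff n

/-- Coefficients of `x(t^e)` off the multiples of `e` vanish. -/
theorem coeff_veroneseT_of_not_dvd (x : B[T;T⁻¹]) {m : ℤ} (hm : ¬ (e : ℤ) ∣ m) : (veroneseT e x).coeff m = 0 := by
  rw [veroneseT_apply, AddMonoidAlgebra.mapDomain, AddMonoidAlgebra.coeff_ofCoeff]
  refine Finsupp.mapDomain_notin_range _ _ ?_
  rintro ⟨n, rfl⟩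
  exact hm ⟨n, rfl⟩

/-- `t ↦ t^e` on monomials. -/
theorem veroneseT_C_mul_T (b : B) (n : ℤ) : veroneseT e (C b * T n) = C b * T ((e : ℤ) * n) := by
  rw [← single_eq_C_mul_T, ← single_eq_C_mul_T, veroneseT_apply, AddMonoidAlgebra.mapDomain_single]
  rfl

include he in
/-- **`t ↦ t^e` maps `R^w` into `R^{e·w}`** (`𝒥ₙ(f,w) = 𝒥_{en}(f, e·w)`). [OURS · L1 W4.5c] -/
theorem veroneseT_mem {x : B[T;T⁻¹]} (hx : x ∈ cobordantAlgebra f w) : veroneseT e x ∈ cobordantAlgebra f (e • w) := by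
  rw [cobordantAlgebra_eq_extendedRees, IdealFiltration.mem_extendedRees_iff] at hx ⊢
  intro n
  by_cases hdvd : (e : ℤ) ∣ (n : ℤ)
  · obtain ⟨m, hm⟩ := hdvd
    have hm0 : 0 ≤ m := by
      by_contra hneg
      have h1 : (e : ℤ) * m < 0 := mul_neg_of_pos_of_neg (by exact_mod_cast he) (lt_of_not_ge hneg)
      have h2 : (0 : ℤ) ≤ (n : ℤ) := Int.natCast_nonneg n
      omega
    obtain ⟨m', rfl⟩ := Int.eq_ofNat_of_zero_le hm0
    rw [hm, coeff_veroneseT_mul he]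
    have hn : n = e * m' := by exact_mod_cast hm
    rw [hn, weightedFiltration_smul_mul f w he]
    exact hx m'
  · rw [coeff_veroneseT_of_not_dvd x hdvd]
    exact Ideal.zero_mem _

/-- **The Veronese embedding** `R^w →+* R^{e·w}`, `t ↦ t^e`. [OURS · L1 W4.5c] -/
def veroneseMap : ↥(cobordantAlgebra f w) →+* ↥(cobordantAlgebra f (e • w)) :=
  ((veroneseT e).restrict (cobordantAlgebra f w).toSubring (cobordantAlgebra f (e • w)).toSubring
    fun _ hx => veroneseT_mem f w he hx)

/-- Underlying Laurent polynomial of `veroneseMap x`. -/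
@[simp] theorem coe_veroneseMap (x : ↥(cobordantAlgebra f w)) :
    ((veroneseMap f w he x : ↥(cobordantAlgebra f (e • w))) : B[T;T⁻¹]) = veroneseT e x := rfl

/-- `s ↦ s^e`. -/
theorem veroneseMap_s : veroneseMap f w he (cobordantAlgebra.s f w) = cobordantAlgebra.s f (e • w) ^ e := by
  apply Subtype.ext
  rw [coe_veroneseMap, cobordantAlgebra.coe_s, cobordantAlgebra.coe_s_pow,
    show (T (-1) : B[T;T⁻¹]) = C 1 * T (-1) by rw [map_one, one_mul], veroneseT_C_mul_T, map_one, one_mul]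
  congr 1; ring

/-- `fᵢ t^{wᵢ} ↦ fᵢ t^{e wᵢ}`. -/
theorem veroneseMap_u' (i : Fin c) : veroneseMap f w he (cobordantAlgebra.u' f w i) = cobordantAlgebra.u' f (e • w) i := by
  apply Subtype.ext
  rw [coe_veroneseMap, cobordantAlgebra.coe_u', cobordantAlgebra.coe_u', veroneseT_C_mul_T]
  congr 2

/-- `b ↦ b` on `B`. -/
theorem veroneseMap_algebraMap (b : B) :
    veroneseMap f w he (algebraMap B _ b) = algebraMap B (↥(cobordantAlgebra f (e • w))) b := by
  apply Subtype.ext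
  rw [coe_veroneseMap, cobordantAlgebra.coe_algebraMap, cobordantAlgebra.coe_algebraMap,
    show (C b : B[T;T⁻¹]) = C b * T 0 by rw [T_zero, mul_one], veroneseT_C_mul_T, mul_zero]

variable (σ : B ≃+* B)
  (hσJ : ∀ n : ℕ, ((weightedFiltration f w).ideal n).map (σ : B →+* B) ≤ (weightedFiltration f w).ideal n)
  {p : ℕ} (hp : 0 < p) (hσp : ∀ x : B, (⇑σ)^[p] x = x)

include he in
/-- `t ↦ t^e` commutes with the coefficientwise `σ`. -/
theorem veroneseT_sigmaT (x : B[T;T⁻¹]) : veroneseT e (sigmaT σ x) = sigmaT σ (veroneseT e x) := by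
  apply AddMonoidAlgebra.coeff_injective
  ext m
  rw [coeff_sigmaT]
  by_cases hdvd : (e : ℤ) ∣ m
  · obtain ⟨n, rfl⟩ := hdvd
    rw [coeff_veroneseT_mul he, coeff_veroneseT_mul he, coeff_sigmaT]
  · rw [coeff_veroneseT_of_not_dvd _ hdvd, coeff_veroneseT_of_not_dvd _ hdvd, map_zero]

/-- **The Veronese embedding intertwines `σ_R`** on `R^w` and on `R^{e·w}`. [OURS · L1 W4.5c] -/
theorem veroneseMap_sigmaR (x : ↥(cobordantAlgebra f w)) :
    veroneseMap f w he (sigmaR σ f w hσJ hp hσp x) =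
      sigmaR σ f (e • w) (map_weightedFiltration_smul_le f w σ he hσJ) hp hσp (veroneseMap f w he x) :=
  Subtype.ext (by rw [coe_veroneseMap, coe_sigmaR, coe_sigmaR, coe_veroneseMap, veroneseT_sigmaT he σ])

/-- The augmentation ideal of `σ_R` goes into that of `σ_{R^{e·w}}`. -/
theorem map_veroneseMap_augmentationIdeal_le :
    (augmentationIdeal (sigmaR σ f w hσJ hp hσp)).map (veroneseMap f w he) ≤
      augmentationIdeal (sigmaR σ f (e • w) (map_weightedFiltration_smul_le f w σ he hσJ) hp hσp) := by
  rw [augmentationIdeal, Ideal.map_span, Ideal.span_le]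
  rintro _ ⟨_, ⟨x, rfl⟩, rfl⟩
  rw [map_sub, veroneseMap_sigmaR]
  exact sub_mem_augmentationIdeal _ _

/-- The vertex ideal goes onto the vertex ideal. -/
theorem map_veroneseMap_vertexIdeal :
    (cobordantAlgebra.vertexIdeal f w).map (veroneseMap f w he) = cobordantAlgebra.vertexIdeal f (e • w) := by
  unfold cobordantAlgebra.vertexIdeal
  rw [Ideal.map_span, ← Set.range_comp]
  congr 1
  ext x
  simp only [Set.mem_range, Function.comp_apply, veroneseMap_u']

/-- ★★ **Certificates scale**: a cobordant kill certificate `β s^δ` for `(f, w)` together with (a′)_δ gives the certificate `β s^{eδ}` for the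
rescaled frame `(f, e·w)` — hence (KC1) the kill clause on every σ-fixed chart of the rescaled frame. [OURS · L1 W4.5c] -/
theorem cobordantKillCert_smul (β : B) (δ : ℕ)
    (hadm : ∀ (n : ℕ) (y : B), y ∈ (weightedFiltration f w).ideal n →
      σ y - y ∈ Ideal.span {β} * (weightedFiltration f w).ideal (n + δ))
    (hcert : CobordantKillCert f w σ hσJ hp hσp (algebraMap B (↥(cobordantAlgebra f w)) β * cobordantAlgebra.s f w ^ δ)) :
    CobordantKillCert f (e • w) σ (map_weightedFiltration_smul_le f w σ he hσJ) hp hσp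
      (algebraMap B (↥(cobordantAlgebra f (e • w))) β * cobordantAlgebra.s f (e • w) ^ (e * δ)) := by
  obtain ⟨-, N, h2⟩ := hcert
  refine ⟨augmentationIdeal_sigmaR_le_span_of_admissible_shift f (e • w) σ _ hp hσp (e * δ) β
    (admissible_smul f w σ he β δ hadm), N, ?_⟩
  have hg : veroneseMap f w he (algebraMap B (↥(cobordantAlgebra f w)) β * cobordantAlgebra.s f w ^ δ) =
      algebraMap B (↥(cobordantAlgebra f (e • w))) β * cobordantAlgebra.s f (e • w) ^ (e * δ) := by
    rw [map_mul, map_pow, veroneseMap_algebraMap, veroneseMap_s, ← pow_mul]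
  have h3 := Ideal.map_mono (f := veroneseMap f w he) h2
  rw [Ideal.map_mul, Ideal.map_pow, map_veroneseMap_vertexIdeal, Ideal.map_span, Set.image_singleton, hg] at h3
  exact h3.trans (map_veroneseMap_augmentationIdeal_le f w he σ hσJ hp hσp)

end Veronese

end Summit.ResolutionOfSingularities.ResolutionOfSingularities.Theorems.WildQuotientResolution.S1.KillCert

end
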